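import Summits.ValiantsHypothesis.ValiantsHypothesis.Theorems.FifoMatchingNNDivisionHardLocatedRowsTogetherFaceWeight
import Literature.Barriers.PneNP.ExtendedFormulationLinearImage
import HarnessLib

/-!
# EXACT PENCILS I — laws are antitone in the rhs (`Tightening`), the pair-cube identities (`gPair`, `dPair`), ONE LAW (`pinnedRows.Law ↔ ExactPencilLaw`) (crux `NNDivisionHard`, stmt-ValiantsHypothesis-21181) — `ExactPencil` port part 1/12

Theorems-side port (staged by val-idea-40 g6, C′-census owner per director-valiant R331 (2)(e) / desk #399, for the port hands;
press as `Theorems/FifoMatchingNNDivisionHardExactPencilTightening.lean`, `--kind proof --supports stmt-ValiantsHypothesis-21181 --as helper`; sig-first val-idea-crit-9 g3) of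
§3, §4 and §6 of val-idea-38 g2's crux workfile `Cruxes/NNDivisionHard/ExactPencil38.lean` REV 16 @4e81d1716f6b (sha16 d9f2e288279a0b09, 3 456 l., FROZEN — final from 38 g2, bus 01:14:51Z; critic of record val-idea-crit-9 g2/g3: `CRITIC-wave6.md` FINAL + V#97 §2 «rev 14/15 δ KERNEL VERIFIED»).  Declaration texts VERBATIM (namespace
`…Theorems.FifoMatching.ExactPencil`; one-line docstrings added where the source had none); the 40-g5 tools the source RESTATED are
DROPPED here and cited BY NAME from the landed ports `…Theorems.FifoMatching.LocatedRows.*` (✓ p680125 … p683387: `T`, `RowFamily`,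
`hCOR`, `exactTilted`, `ExactPencilLaw`, `pinnedRows`, `unflat`, `three_pow_le_of_block`, `two_pow_half_mul_le`, `zgen`, `cubePt`, …) and
`…Theorems.FifoMatching.XcDivision` (`udRow`, `udPt`, `udInd`, `udMat`, …), so that C′ stays ONE Theorems declaration
`LocatedRows.ExactPencilLaw`.  Part 1/12 of the port (imports the landed `…LocatedRowsTogetherFaceWeight`, i.e. the whole landed `LocatedRows` chain, and nothing from `Cruxes/`).

* §3 `Tightening`, `two_mul_T_le`, ★ `RowFamily.Law.of_tightening` (a law for the LOOSER family implies the law for its tightening),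
  `exactTilted_tightening_entryTilted` (so `RowFamily.Law.of_tightening exactTilted_tightening_entryTilted : LocatedPencilLaw → ExactPencilLaw`
  is the non-vacuous proof; the implication itself is landed, vacuously, as `…NNDivisionHardNegative.LocatedRows.exactPencilLaw_of_locatedPencilLaw`);
* §4 `gPair` (`g_jm = E_jj + E_mm + 2(E_jm + E_mj)`), `udRow_dotProduct_gPair`, `dPair`, the pin identities `flat_dPair_dotProduct_gPair_*`;
* §6 `hCOR_unflat_eq`, `exactTilted_emb_pinnedRows`, ★★ `pinnedRowsLaw_iff_exactPencilLaw` (C′ has ONE meaning).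

HONEST LABEL: every theorem here is a DECIDED SPECIES / support lemma for the OPEN law C′ = `LocatedRows.ExactPencilLaw`
(`exactTilted.Law`); the crux 21181 `NNDivisionHard`, C′, `allRows.Law` and COR-VIRTUAL are OPEN; C⁺_entry `LocatedPencilLaw` is
REFUTED (✓ p679540).  VP ≠ VNP is NOT proved here or anywhere in this tree.
-/

set_option autoImplicit false

-- the mandated summit-side namespace repeats a component by design (single-problem summit)
set_option linter.dupNamespace false

noncomputable section

open Matrix Finset
open scoped Pointwise

namespace Summit.ValiantsHypothesis.ValiantsHypothesis.Theorems.FifoMatching.ExactPencil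

open Literature.Barriers.PneNP (HasEFOfSize three_pow_le_card_mul_two_pow_of_cover_univ)
open Literature.Combinatorics.Optimization.FixedSizePsdRank
  (corPolytope flat vecOuter flat_dotProduct_le_of_mem_corPolytope flat_dotProduct_vecOuter)
open Summit.ValiantsHypothesis.ValiantsHypothesis.Theorems.FifoMatching.XcDivision
  (udRow udPt udInd udMat ud_data udInd_apply udInd_sq dot_le_of_mem_convexHull flat_dotProduct_flat)
open Summit.ValiantsHypothesis.ValiantsHypothesis.Theorems.FifoMatching.LocatedRows
  (T CorVirtualHardN RowFamily corVirtualHardN_of_law flat_le_box entryTilted allRows LocatedPencilLaw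
    hCOR le_hCOR exists_eq_hCOR flat_le_hCOR hCOR_le_box exactTilted ExactPencilLaw exactTilted_emb_allRows
    corVirtualHardN_of_exactPencilLaw three_pow_le_of_block two_pow_half_mul_le pinnedRows unflat flat_unflat
    pinnedRows_emb_exactTilted corVirtualHardN_of_pinnedRowsLaw zgen cubePt dotProduct_cubePt)

/-! ## §3 Laws are antitone in the right-hand side -/

/-- `F` is a TIGHTENING of `G`: every row of `G` is (a copy of) a row of `F` whose right-hand side in `F` is not larger. -/
structure Tightening (F G : RowFamily) where
  ψ : ∀ n, G.A n → F.A n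
  ρ_eq : ∀ n a, F.ρ n (ψ n a) = G.ρ n a
  β_le : ∀ n a, F.β n (ψ n a) ≤ G.β n a

/-- `2 · T c n ≤ T (c+1) n` once `n ≥ 2` (one extra slot is free at the next level of the quasi-polynomial scale). -/
theorem two_mul_T_le (c : ℕ) {n : ℕ} (hn : 2 ≤ n) : 2 * T c n ≤ T (c + 1) n := by
  have hL : 1 ≤ Nat.log 2 n := Nat.le_log_of_pow_le (by norm_num) (by simpa using hn)
  show 2 * 2 ^ ((Nat.log 2 n + c) ^ c) ≤ 2 ^ ((Nat.log 2 n + (c + 1)) ^ (c + 1))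
  rw [← pow_succ']
  apply Nat.pow_le_pow_right (by norm_num)
  set x := Nat.log 2 n + c with hx
  have hx1 : 1 ≤ x := by omega
  have h1 : Nat.log 2 n + (c + 1) = x + 1 := by omega
  rw [h1, pow_succ]
  have hA : 1 ≤ x ^ c := Nat.one_le_pow _ _ (by omega)
  have hB : x ^ c ≤ (x + 1) ^ c := Nat.pow_le_pow_left (by omega) c
  nlinarith [hA, hB, hx1]

/-- ★ **LAWS ARE ANTITONE IN THE RHS**: a law for the LOOSER family `G` implies the law for its tightening `F`
(a cheap factorization of the tight `F`-slack plus the single slot `(β_G a − β_F (ψ a)) · 1` factors the `G`-slack). -/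
theorem RowFamily.Law.of_tightening {F G : RowFamily} (t : Tightening F G) (hG : G.Law) : F.Law := by
  classical
  intro c
  obtain ⟨n₀, hn₀⟩ := hG (c + 1)
  refine ⟨max n₀ 2, fun n hn K q r hQ m hmq hmax U V hU hV hfac => ?_⟩
  have hn₀' : n₀ ≤ n := le_trans (le_max_left _ _) hn
  have hn2 : 2 ≤ n := le_trans (le_max_right _ _) hn
  -- the loosened factorization through `Option (Fin (r+1))`: slot `none` carries the rhs difference
  let e : Fin (r + 1) ≃ Option (Fin r) := finSuccEquiv r
  let U' : G.A n → Option (Fin (r + 1)) → ℝ := fun a o =>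
    match o with
    | none => G.β n a - F.β n (t.ψ n a)
    | some i => U (t.ψ n a) (e i)
  let V' : Finset (Fin n) × Fin (K + 1) → Option (Fin (r + 1)) → ℝ := fun p o =>
    match o with
    | none => 1
    | some i => V p (e i)
  have hU' : ∀ a o, 0 ≤ U' a o := by
    intro a o; cases o with
    | none => exact sub_nonneg.2 (t.β_le n a)
    | some i => exact hU _ _
  have hV' : ∀ p o, 0 ≤ V' p o := by
    intro p o; cases o with
    | none => exact zero_le_one
    | some i => exact hV _ _
  have hfac' : ∀ a b j, (G.β n a + m (t.ψ n a)) - G.ρ n a ⬝ᵥ (udPt b + q j) = ∑ o, U' a o * V' (b, j) o := by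
    intro a b j
    rw [Fintype.sum_option]
    have hs : ∑ i : Fin (r + 1), U' a (some i) * V' (b, j) (some i) =
        ∑ o : Option (Fin r), U (t.ψ n a) o * V (b, j) o := by
      show ∑ i : Fin (r + 1), U (t.ψ n a) (e i) * V (b, j) (e i) = _
      exact Equiv.sum_comp e (fun o => U (t.ψ n a) o * V (b, j) o)
    rw [hs, ← hfac (t.ψ n a) b j, t.ρ_eq n a]
    show (G.β n a + m (t.ψ n a)) - G.ρ n a ⬝ᵥ (udPt b + q j) =
      (G.β n a - F.β n (t.ψ n a)) * 1 + ((F.β n (t.ψ n a) + m (t.ψ n a)) - G.ρ n a ⬝ᵥ (udPt b + q j))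
    ring
  have hlt : T (c + 1) n < r + 1 :=
    hn₀ n hn₀' K q (r + 1) hQ.succ (fun a => m (t.ψ n a))
      (fun a j => by rw [← t.ρ_eq n a]; exact hmq _ j)
      (fun a => by obtain ⟨j, hj⟩ := hmax (t.ψ n a); exact ⟨j, by rw [← t.ρ_eq n a]; exact hj⟩)
      U' V' hU' hV' hfac'
  have h2 := two_mul_T_le c hn2
  have hT : 1 ≤ T c n := Nat.one_le_two_pow
  omega

/-- the box pencil `entryTilted` is a LOOSENING of the exact pencil (`h_COR(W) ≤ Σ max(W_im, 0)`). -/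
noncomputable def exactTilted_tightening_entryTilted : Tightening exactTilted entryTilted where
  ψ := fun _ a => a
  ρ_eq := fun _ _ => rfl
  β_le := fun n a => by
    show (1 : ℝ) + hCOR a.2 ≤ 1 + ∑ i, ∑ m, max (a.2 i m) 0
    have := hCOR_le_box a.2
    linarith

/-! ## §4 The pair cube `Q_pair`: clique weights and the exact pairing pin (the separating example, identities only)

`Q_pair := Σ_{j<m} [0, g_jm]`, `g_jm = E_jj + E_mm + 2(E_jm + E_mj)` (`xc ≤ n(n−1)`); clique weights `⟨udRow a, g_jm⟩ = [j∈a] + [m∈a]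
− 4[j∈a][m∈a] ∈ {0, 1, −2}` (`udRow_dotProduct_gPair`); against the matched-pair direction `d_jj' = E_jj + E_j'j' − E_jj' − E_j'j` the pair's
own generator answers `−2`, a touching one `+1`, a disjoint one `0` (`flat_dPair_dotProduct_gPair_self/_touch/_disjoint`) — summed over a
perfect matching `π`: `−2` on `π`, `+2` off `π`, so `μ = 2` beats every clique weight, the common maximiser is `πᶜ` and the exact pencil
slack has the block `UDISJ_{n/2}` (§5). -/

/-- pick out one entry: `Σ_i Σ_i' f i i' · [i = j ∧ i' = m]·c = c · f j m`. -/
theorem sum_sum_mul_ite_and {n : ℕ} (f : Fin n → Fin n → ℝ) (c : ℝ) (j m : Fin n) :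
    ∑ i, ∑ i', f i i' * (if i = j ∧ i' = m then c else 0) = c * f j m := by
  have : ∀ i i' : Fin n, f i i' * (if i = j ∧ i' = m then c else 0) =
      if i' = m then (if i = j then c * f i i' else 0) else 0 := by
    intro i i'
    by_cases hi : i = j <;> by_cases hi' : i' = m <;> simp [hi, hi', mul_comm]
  simp_rw [this]
  simp only [Finset.sum_ite_eq', Finset.mem_univ, if_true]

/-- the generator `g_jm = E_jj + E_mm + 2(E_jm + E_mj)` of the PAIR CUBE `Q_pair = Σ_{j<m} [0, g_jm]`. -/
def gPair {n : ℕ} (j m : Fin n) : Matrix (Fin n) (Fin n) ℝ := fun i i' =>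
  (if i = j ∧ i' = j then (1 : ℝ) else 0) + (if i = m ∧ i' = m then (1 : ℝ) else 0) +
    (if i = j ∧ i' = m then (2 : ℝ) else 0) + (if i = m ∧ i' = j then (2 : ℝ) else 0)

/-- ★ the clique weight of a pair generator: `⟨udRow a, g_jm⟩ = [j∈a] + [m∈a] − 4[j∈a][m∈a]` ∈ {0, 1, −2}
(private maximiser `H*(a) ⊇ δ(a)`, `H*(a) ∩ E(a) = ∅`; relief `|a|` per decoded-extra element — the weak direction). -/
theorem udRow_dotProduct_gPair {n : ℕ} (a : Finset (Fin n)) {j m : Fin n} (hjm : j ≠ m) :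
    udRow a ⬝ᵥ flat (gPair j m) = udInd a j + udInd a m - 4 * (udInd a j * udInd a m) := by
  rw [show udRow a = flat (udMat a) from rfl, flat_dotProduct_flat]
  simp only [gPair, mul_add, Finset.sum_add_distrib, sum_sum_mul_ite_and]
  simp [udMat, hjm, Ne.symm hjm, udInd_sq]
  ring

/-- the pairing-face direction of ONE matched pair: `d_jj' = E_jj + E_j'j' − E_jj' − E_j'j` (`⟨d, x_b⟩ = [b_j ≠ b_j']`). -/
def dPair {n : ℕ} (j j' : Fin n) : Matrix (Fin n) (Fin n) ℝ := fun i i' =>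
  (if i = j ∧ i' = j then (1 : ℝ) else 0) + (if i = j' ∧ i' = j' then (1 : ℝ) else 0) +
    (if i = j ∧ i' = j' then (-1 : ℝ) else 0) + (if i = j' ∧ i' = j then (-1 : ℝ) else 0)

/-- ★ THE PIN: the matched pair's own generator answers `−2`, a generator sharing exactly the vertex `j` answers `+1`
(so over a perfect matching `π`, `⟨C_π, g_e⟩ = +2` for `e ∉ π` and `−2` for `e ∈ π`: EVERY generator of `Q_pair` is pinned). -/
theorem flat_dPair_dotProduct_gPair_self {n : ℕ} {j j' : Fin n} (h : j ≠ j') :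
    flat (dPair j j') ⬝ᵥ flat (gPair j j') = -2 := by
  rw [flat_dotProduct_flat]
  simp only [gPair, mul_add, Finset.sum_add_distrib, sum_sum_mul_ite_and]
  simp [dPair, h, Ne.symm h]
  norm_num

/-- a pin direction `d_{jj'}` reads `1` on a generator `g_{jm}` touching exactly one of its indices. -/
theorem flat_dPair_dotProduct_gPair_touch {n : ℕ} {j j' m : Fin n} (h : j ≠ j') (hm : m ≠ j) (hm' : m ≠ j') :
    flat (dPair j j') ⬝ᵥ flat (gPair j m) = 1 := by
  rw [flat_dotProduct_flat]
  simp only [gPair, mul_add, Finset.sum_add_distrib, sum_sum_mul_ite_and]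
  simp [dPair, h, hm, hm']

/-- a pin direction `d_{jj'}` reads `0` on a generator `g_{lm}` disjoint from `{j, j'}`. -/
theorem flat_dPair_dotProduct_gPair_disjoint {n : ℕ} {j j' l m : Fin n} (hl : l ≠ j) (hl' : l ≠ j')
    (hm : m ≠ j) (hm' : m ≠ j') :
    flat (dPair j j') ⬝ᵥ flat (gPair l m) = 0 := by
  rw [flat_dotProduct_flat]
  simp only [gPair, mul_add, Finset.sum_add_distrib, sum_sum_mul_ite_and]
  simp [dPair, hl, hl', hm, hm']

/-! ## §6 (rev 3) One law, two presentations: `pinnedRows.Law ↔ ExactPencilLaw` -/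

section OneLaw

/-- a direction maximised over `COR(n)` at the vertex `x_S` has `h_COR = ⟨·, x_S⟩`. -/
theorem hCOR_unflat_eq {n : ℕ} (w : Fin (n * n) → ℝ) (S : Finset (Fin n))
    (h : ∀ x ∈ corPolytope n, w ⬝ᵥ x ≤ w ⬝ᵥ udPt S) : hCOR (unflat w) = w ⬝ᵥ udPt S := by
  apply le_antisymm
  · refine Finset.sup'_le _ _ fun b _ => ?_
    rw [flat_unflat]; exact h _ ((ud_data n).1 b)
  · have := le_hCOR (unflat w) S
    rwa [flat_unflat] at this

/-- `exactTilted ↪ pinnedRows` (pin at a maximising vertex of `h_COR`). -/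
noncomputable def exactTilted_emb_pinnedRows : RowFamily.Emb exactTilted pinnedRows where
  φ := fun _ a => (a.1, ⟨(flat a.2, Classical.choose (exists_eq_hCOR a.2)), fun x hx => by
      rw [Classical.choose_spec (exists_eq_hCOR a.2)]; exact flat_le_hCOR a.2 x hx⟩)
  ρ_eq := fun _ _ => rfl
  β_eq := fun n a => by
    show (1 : ℝ) + flat a.2 ⬝ᵥ udPt (Classical.choose (exists_eq_hCOR a.2)) = 1 + hCOR a.2
    rw [Classical.choose_spec (exists_eq_hCOR a.2)]

/-- ★★ **ONE LAW**: `pinnedRows.Law ↔ ExactPencilLaw` — N22's repaired statement C′ has a single meaning. -/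
theorem pinnedRowsLaw_iff_exactPencilLaw : pinnedRows.Law ↔ ExactPencilLaw :=
  ⟨fun h => RowFamily.Law.mono pinnedRows_emb_exactTilted h, fun h => RowFamily.Law.mono exactTilted_emb_pinnedRows h⟩

end OneLaw

end Summit.ValiantsHypothesis.ValiantsHypothesis.Theorems.FifoMatching.ExactPencil
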